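import Mathlib
import Summits.ValiantsHypothesis.ValiantsHypothesis.Theses.LiouvilleSarnak
import Summits.ValiantsHypothesis.ValiantsHypothesis.Theorems.LiouvilleSarnakLiouvilleCutRankBlockEntropy
import Summits.ValiantsHypothesis.ValiantsHypothesis.Theorems.LiouvilleSarnakLiouvilleCutRankGramCount
import Literature.NumberTheory.Sieve.ParityWave0LogChowlaProofs

/-!
# Route LiouvilleSarnak — crux `LiouvilleCutRank` (stmt-ValiantsHypothesis-14775):
# FOUR-POINT LOGARITHMIC CHOWLA ALONG 4-ADIC PROGRESSIONS IMPLIES THE CRUX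

The crux `LiouvilleCutRank` (for every `W`, eventually every balanced digital cut matrix
`M_π(r, c) = λ(N_π(r, c) + 1)` of the Liouville function has rank `≥ W`) is, by
`OneBlock.liouvilleCutRank_iff_oneBlock_distinctRows`, equivalent to: for every `D` there is a
scale `ℓ` such that for every balanced cut word `π₁` of `2ℓ` bit positions SOME aligned block
`[4^ℓ H + 1, 4^ℓ (H + 1)]` of `λ`, read through `π₁` as a `2^ℓ × 2^ℓ` sign matrix
`B_H(r, c) = λ(4^ℓ H + N_{π₁}(r, c) + 1)`, shows `≥ D` distinct rows.

This file identifies the EXACT ORDER of multiplicative-correlation input that suffices: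

* Tools (`Theorems/LiouvilleSarnakLiouvilleCutRankGramCount.lean`): the GRAM / FOURTH-MOMENT COUNT
  `GramCount.card_sq_le_of_image_card_le` — if a `±1` matrix `B` on `I × K` has at most `D`
  distinct rows then
  `(I K)² ≤ D · Σ_{r ≠ r'} Σ_{c ≠ c'} B(r,c) B(r',c) B(r,c') B(r',c') + D · I K (I + K)`, so few
  distinct rows force the off-diagonal FOUR-FOLD sum to be `≥ N³` once `N = 2^ℓ ≥ 3D`; and
  `GramCount.not_isLittleO_log_of_one_le` — a sequence `≥ 1` is not `o(log x)` in logarithmic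
  average.
* ★ `liouvilleCutRank_of_fourPoint_logChowla` — if for every `ℓ` and every four DISTINCT shifts
  `1 ≤ b_i ≤ 4^ℓ` the logarithmically averaged four-point correlation along the progression of
  modulus `4^ℓ` vanishes, `Σ_{n ≤ x} λ(4^ℓ n + b₁) λ(4^ℓ n + b₂) λ(4^ℓ n + b₃) λ(4^ℓ n + b₄) / n = o(log x)`,
  then `LiouvilleCutRank` holds.  Proof: if every aligned block `B_H`, `H ≥ 1`, had `< D` distinct
  `π₁`-rows, the Gram count makes the off-diagonal four-fold sum of `B_H` at least `1` for EVERY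
  `H`; its logarithmic average over `H ≤ x` is a finite sum (over the digital rectangles
  `(r, c), (r', c), (r, c'), (r', c')`, four distinct addresses) of the hypothesis' `o(log x)`
  quantities — impossible for a sequence `≥ 1`.
* `liouvilleCutRank_of_logChowla_dilated` — corollary in the printed shape of the
  logarithmically averaged Chowla conjecture WITH DILATIONS (Tao–Teräväinen, J. Théor. Nombres
  Bordeaux 30 (2018) Thm 1.1 proves the ODD orders; in the tree the odd orders are the named fact
  `Literature.NumberTheory.Sieve.liouville_logCorrelation_isLittleO_of_odd` and the order `k = 2`
  with dilations is PROVED, `Literature.NumberTheory.Sieve.tao_log_chowla_liouville_holds`): the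
  full conjecture (all `k`, `a_i ≥ 1`, `a_i b_j ≠ a_j b_i`) implies the crux, and only its case
  `k = 4`, equal dilations `a_i = 4^ℓ`, is used.

Where this puts the crux.  Order two cannot suffice for ANY argument of this kind: the uniform
measure on rank-one sign blocks `x(r) y(c)` has the same pair correlations
`E[x_r y_c x_{r'} y_{c'}] = [r = r'][c = c']` as the uniform measure on all sign blocks (recorded in
the companion file `…LiouvilleCutRankPairCorrelationBarrier.lean` of this series), and odd orders
are theorems (Tao–Teräväinen); so the minimal analytic input for `LiouvilleCutRank` along this
line is exactly the FIRST OPEN CASE `k = 4` of the logarithmic Chowla conjecture, here only along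
the progressions `n ≡ b (mod 4^ℓ)` with the four shifts inside one block.  Compare the tree's bridges from the full
Chowla conjecture (`…LiouvilleCutRankChowla`), from Sarnak's conjecture (`…LiouvilleCutRankSarnak`)
and from positive pattern entropy (`…LiouvilleCutRankBlockEntropy`): all three hypotheses imply
every even-order case; the present one is a single order, logarithmically averaged.

Honest framing: a conditional bridge; the hypothesis is OPEN (it is the `k = 4` case of the
logarithmically averaged Chowla conjecture), `LiouvilleCutRank`, `DigitalBilinearLiouville` and
`AlgebraicSarnak` stay OPEN, and nothing here bears on VP versus VNP.  No definitions (the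
hypotheses are written out verbatim).
-/

-- the directory `ValiantsHypothesis/ValiantsHypothesis` repeats the summit name (tree layout)
set_option linter.dupNamespace false

namespace Summit.ValiantsHypothesis.ValiantsHypothesis.Theorems.LiouvilleSarnakLiouvilleCutRank.FourPoint

open Finset ArithmeticFunction Filter Asymptotics

open Summit.ValiantsHypothesis.ValiantsHypothesis.Theses.LiouvilleSarnak (LiouvilleCutRank)
open Summit.ValiantsHypothesis.ValiantsHypothesis.Theorems.LiouvilleSarnakLiouvilleCutRank.OneBlock
  (liouvilleCutRank_iff_oneBlock_distinctRows)
open Summit.ValiantsHypothesis.ValiantsHypothesis.Theorems.LiouvilleSarnakLiouvilleCutRank.BlockEntropy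
  (card_image_blockRows_eq liouville_succ_eq_or)
open Summit.ValiantsHypothesis.ValiantsHypothesis.Theorems.LiouvilleSarnakLiouvilleCutRank.GramCount
  (card_sq_le_of_image_card_le not_isLittleO_log_of_one_le)

/-! ### Four-point logarithmic Chowla along 4-adic progressions ⇒ `LiouvilleCutRank` -/

/-- The cut address `N_{π₁}(r, c)` determines the pair `(r, c)`. [folklore] -/
theorem cutAddress_injective (ℓ : ℕ) (π₁ : Fin ℓ ⊕ Fin ℓ ≃ Fin (2 * ℓ)) (r r' c c' : Fin ℓ → Bool)
    (h : Nat.ofBits (fun j : Fin (2 * ℓ) => Sum.elim r c (π₁.symm j)) =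
      Nat.ofBits (fun j : Fin (2 * ℓ) => Sum.elim r' c' (π₁.symm j))) : r = r' ∧ c = c' := by
  have hfun : (fun j : Fin (2 * ℓ) => Sum.elim r c (π₁.symm j)) =
      fun j : Fin (2 * ℓ) => Sum.elim r' c' (π₁.symm j) := by
    funext j
    have hj := congrArg (fun x : ℕ => x.testBit (j : ℕ)) h
    simpa [Nat.testBit_ofBits_lt _ _ j.isLt] using hj
  constructor
  · funext i
    have := congrFun hfun (π₁ (Sum.inl i))
    simpa using this
  · funext i
    have := congrFun hfun (π₁ (Sum.inr i))
    simpa using this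

/-- ★ **Four-point logarithmic Chowla along 4-adic progressions implies `LiouvilleCutRank`.**
Hypothesis (the case `k = 4`, equal dilations `a_i = 4^ℓ`, of the logarithmically averaged Chowla
conjecture; OPEN): for every `ℓ` and every four pairwise distinct shifts `1 ≤ b_i ≤ 4^ℓ`,
`Σ_{1 ≤ n ≤ x} λ(4^ℓ n + b₁) λ(4^ℓ n + b₂) λ(4^ℓ n + b₃) λ(4^ℓ n + b₄) / n = o(log x)`.
Conclusion: for every `W`, eventually every balanced digital cut matrix of `λ` has rank `≥ W`.
Proof: given `D` take `ℓ` with `2^ℓ ≥ 3D`; if for some balanced cut word `π₁` every aligned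
`4^ℓ`-block `B_H` had `< D` distinct `π₁`-rows, the Gram count (`GramCount`, `N = 2^ℓ`) gives
`N⁴ ≤ (D-1)(OffDiag(B_H) + 2N³)`, so `OffDiag(B_H) ≥ N³ ≥ 1` for every `H`; but the logarithmic
average of `OffDiag(B_H)` over `H ≤ x` is a finite sum of four-point correlations with the distinct
shifts `N(r,c)+1, N(r',c)+1, N(r,c')+1, N(r',c')+1` (`r ≠ r'`, `c ≠ c'`), hence `o(log x)` —
impossible for a sequence `≥ 1` (`GramCount.not_isLittleO_log_of_one_le`).  Then `OneBlock.liouvilleCutRank_iff_oneBlock_distinctRows`. [folklore] -/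
theorem liouvilleCutRank_of_fourPoint_logChowla
    (h4 : ∀ ℓ b₁ b₂ b₃ b₄ : ℕ, b₁ ≠ b₂ → b₁ ≠ b₃ → b₁ ≠ b₄ → b₂ ≠ b₃ → b₂ ≠ b₄ → b₃ ≠ b₄ →
      1 ≤ b₁ → 1 ≤ b₂ → 1 ≤ b₃ → 1 ≤ b₄ →
      b₁ ≤ 2 ^ (2 * ℓ) → b₂ ≤ 2 ^ (2 * ℓ) → b₃ ≤ 2 ^ (2 * ℓ) → b₄ ≤ 2 ^ (2 * ℓ) →
      (fun x : ℕ => ∑ n ∈ Icc 1 x,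
        ((liouville (2 ^ (2 * ℓ) * n + b₁) : ℝ) * (liouville (2 ^ (2 * ℓ) * n + b₂) : ℝ) *
          (liouville (2 ^ (2 * ℓ) * n + b₃) : ℝ) * (liouville (2 ^ (2 * ℓ) * n + b₄) : ℝ)) / n)
        =o[atTop] fun x : ℕ => Real.log x) :
    LiouvilleCutRank := by
  classical
  rw [liouvilleCutRank_iff_oneBlock_distinctRows]
  intro D
  -- a scale with `3 D ≤ 2^ℓ`
  obtain ⟨ℓ, hℓ⟩ : ∃ ℓ : ℕ, 3 * D ≤ 2 ^ ℓ := ⟨3 * D, Nat.lt_two_pow_self.le⟩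
  refine ⟨ℓ, fun π₁ => ?_⟩
  by_contra hcon
  push Not at hcon
  -- notation: addresses and the integer block matrices
  set N : (Fin ℓ → Bool) → (Fin ℓ → Bool) → ℕ := fun r c =>
    Nat.ofBits (fun j : Fin (2 * ℓ) => Sum.elim r c (π₁.symm j)) with hNdef
  set B : ℕ → (Fin ℓ → Bool) → (Fin ℓ → Bool) → ℤ := fun H r c =>
    (liouville (N r c + 2 ^ (2 * ℓ) * H + 1) : ℤ) with hBdef
  have hB : ∀ H r c, B H r c = 1 ∨ B H r c = -1 := fun H r c => liouville_succ_eq_or _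
  have hNinj : ∀ r r' c c', N r c = N r' c' → r = r' ∧ c = c' :=
    fun r r' c c' h => cutAddress_injective ℓ π₁ r r' c c' h
  have hNle : ∀ r c, N r c + 1 ≤ 2 ^ (2 * ℓ) := fun r c => Nat.ofBits_lt_two_pow _
  -- every block has `≤ D - 1` distinct (integer) rows
  have hrows : ∀ H, ((univ : Finset (Fin ℓ → Bool)).image (B H)).card ≤ D - 1 := by
    intro H
    have h1 := hcon H
    rw [card_image_blockRows_eq ℓ H π₁] at h1
    exact Nat.le_sub_one_of_lt h1
  have hcardN : Fintype.card (Fin ℓ → Bool) = 2 ^ ℓ := by simp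
  -- the off-diagonal four-fold sum of every block is `≥ 1`
  set OD : ℕ → ℤ := fun H => ∑ p ∈ (univ : Finset (Fin ℓ → Bool)).offDiag,
      ∑ q ∈ (univ : Finset (Fin ℓ → Bool)).offDiag,
        B H p.1 q.1 * B H p.2 q.1 * B H p.1 q.2 * B H p.2 q.2 with hOD
  have hOD1 : ∀ H, 1 ≤ OD H := by
    intro H
    have hG := card_sq_le_of_image_card_le (B H) (hB H) (D - 1) (hrows H)
    rw [hcardN] at hG
    -- `1 ≤ D - 1`: a block has at least one row
    have hD1 : 1 ≤ D - 1 := by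
      have h0 : 0 < ((univ : Finset (Fin ℓ → Bool)).image (B H)).card :=
        card_pos.mpr ⟨B H (fun _ => false), mem_image_of_mem _ (mem_univ _)⟩
      have := hrows H
      omega
    set D' : ℕ := D - 1 with hD'
    have hM3 : 3 * D' ≤ 2 ^ ℓ := le_trans (by omega) hℓ
    -- cast everything to `ℤ`
    have hM3' : 3 * (D' : ℤ) ≤ (2 : ℤ) ^ ℓ := by exact_mod_cast hM3
    have hD1' : (1 : ℤ) ≤ (D' : ℤ) := by exact_mod_cast hD1
    have hG' : (((2 ^ ℓ : ℕ) : ℤ) * ((2 ^ ℓ : ℕ) : ℤ)) ^ 2 ≤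
        (D' : ℤ) * OD H + (D' : ℤ) * (((2 ^ ℓ : ℕ) : ℤ) * ((2 ^ ℓ : ℕ) : ℤ) *
          (((2 ^ ℓ : ℕ) : ℤ) + ((2 ^ ℓ : ℕ) : ℤ))) := hG
    push_cast at hG'
    set M : ℤ := (2 : ℤ) ^ ℓ with hM
    have hM1 : (3 : ℤ) ≤ M := by linarith
    have hM3pos : (0 : ℤ) ≤ M * M * M := by positivity
    have h1 : 3 * (D' : ℤ) * (M * M * M) ≤ M * (M * M * M) :=
      mul_le_mul_of_nonneg_right hM3' hM3pos
    have h2 : (27 : ℤ) ≤ M * M * M := by nlinarith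
    have h3 : (D' : ℤ) * 27 ≤ (D' : ℤ) * (M * M * M) :=
      mul_le_mul_of_nonneg_left h2 (by positivity)
    by_contra hlt
    push Not at hlt
    have h4' : (D' : ℤ) * OD H < (D' : ℤ) * 1 := mul_lt_mul_of_pos_left hlt (by linarith)
    nlinarith
  -- the four-fold products as products of four Liouville values in one progression
  have e : ∀ m H : ℕ, m + 2 ^ (2 * ℓ) * H + 1 = 2 ^ (2 * ℓ) * H + (m + 1) := by intros; ring
  have hterm : ∀ (H : ℕ) (p q : (Fin ℓ → Bool) × (Fin ℓ → Bool)),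
      ((B H p.1 q.1 * B H p.2 q.1 * B H p.1 q.2 * B H p.2 q.2 : ℤ) : ℝ) =
        ((liouville (2 ^ (2 * ℓ) * H + (N p.1 q.1 + 1)) : ℝ) *
          (liouville (2 ^ (2 * ℓ) * H + (N p.2 q.1 + 1)) : ℝ) *
          (liouville (2 ^ (2 * ℓ) * H + (N p.1 q.2 + 1)) : ℝ) *
          (liouville (2 ^ (2 * ℓ) * H + (N p.2 q.2 + 1)) : ℝ)) := by
    intro H p q
    simp only [hBdef, e]
    push_cast
    rfl
  have hODr : ∀ n : ℕ, (OD n : ℝ) =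
      ∑ p ∈ (univ : Finset (Fin ℓ → Bool)).offDiag, ∑ q ∈ (univ : Finset (Fin ℓ → Bool)).offDiag,
        ((liouville (2 ^ (2 * ℓ) * n + (N p.1 q.1 + 1)) : ℝ) *
          (liouville (2 ^ (2 * ℓ) * n + (N p.2 q.1 + 1)) : ℝ) *
          (liouville (2 ^ (2 * ℓ) * n + (N p.1 q.2 + 1)) : ℝ) *
          (liouville (2 ^ (2 * ℓ) * n + (N p.2 q.2 + 1)) : ℝ)) := by
    intro n
    simp only [hOD]
    rw [Int.cast_sum]
    refine sum_congr rfl fun p _ => ?_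
    rw [Int.cast_sum]
    exact sum_congr rfl fun q _ => hterm n p q
  have hsumeq : ∀ x : ℕ, ∑ n ∈ Icc 1 x, (OD n : ℝ) / n =
      ∑ p ∈ (univ : Finset (Fin ℓ → Bool)).offDiag, ∑ q ∈ (univ : Finset (Fin ℓ → Bool)).offDiag,
        ∑ n ∈ Icc 1 x,
          ((liouville (2 ^ (2 * ℓ) * n + (N p.1 q.1 + 1)) : ℝ) *
            (liouville (2 ^ (2 * ℓ) * n + (N p.2 q.1 + 1)) : ℝ) *
            (liouville (2 ^ (2 * ℓ) * n + (N p.1 q.2 + 1)) : ℝ) *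
            (liouville (2 ^ (2 * ℓ) * n + (N p.2 q.2 + 1)) : ℝ)) / n := by
    intro x
    calc ∑ n ∈ Icc 1 x, (OD n : ℝ) / n
        = ∑ n ∈ Icc 1 x, ∑ p ∈ (univ : Finset (Fin ℓ → Bool)).offDiag,
            ∑ q ∈ (univ : Finset (Fin ℓ → Bool)).offDiag,
              ((liouville (2 ^ (2 * ℓ) * n + (N p.1 q.1 + 1)) : ℝ) *
                (liouville (2 ^ (2 * ℓ) * n + (N p.2 q.1 + 1)) : ℝ) *
                (liouville (2 ^ (2 * ℓ) * n + (N p.1 q.2 + 1)) : ℝ) *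
                (liouville (2 ^ (2 * ℓ) * n + (N p.2 q.2 + 1)) : ℝ)) / n := by
          refine sum_congr rfl fun n _ => ?_
          rw [hODr n, sum_div]
          refine sum_congr rfl fun p _ => ?_
          rw [sum_div]
      _ = _ := by
          rw [sum_comm]
          exact sum_congr rfl fun p _ => sum_comm
  -- hence the logarithmic average of `OD` is `o(log x)`
  have hlittle : (fun x : ℕ => ∑ n ∈ Icc 1 x, (OD n : ℝ) / n) =o[atTop]
      fun x : ℕ => Real.log x := by
    rw [show (fun x : ℕ => ∑ n ∈ Icc 1 x, (OD n : ℝ) / n) = _ from funext hsumeq]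
    refine IsLittleO.sum fun p hp => IsLittleO.sum fun q hq => ?_
    have hpne : p.1 ≠ p.2 := (mem_offDiag.mp hp).2.2
    have hqne : q.1 ≠ q.2 := (mem_offDiag.mp hq).2.2
    refine h4 ℓ (N p.1 q.1 + 1) (N p.2 q.1 + 1) (N p.1 q.2 + 1) (N p.2 q.2 + 1)
      ?_ ?_ ?_ ?_ ?_ ?_ (by omega) (by omega) (by omega) (by omega)
      (hNle _ _) (hNle _ _) (hNle _ _) (hNle _ _)
    · exact fun h => hpne (hNinj _ _ _ _ (Nat.succ_injective h)).1
    · exact fun h => hqne (hNinj _ _ _ _ (Nat.succ_injective h)).2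
    · exact fun h => hpne (hNinj _ _ _ _ (Nat.succ_injective h)).1
    · exact fun h => hpne (hNinj _ _ _ _ (Nat.succ_injective h)).1.symm
    · exact fun h => hqne (hNinj _ _ _ _ (Nat.succ_injective h)).2
    · exact fun h => hpne (hNinj _ _ _ _ (Nat.succ_injective h)).1
  exact not_isLittleO_log_of_one_le (a := fun n => (OD n : ℝ))
    (fun n _ => by exact_mod_cast hOD1 n) hlittle

/-- **Corollary in the printed shape.**  The logarithmically averaged Chowla conjecture WITH
DILATIONS — for every `k`, all `a_i ≥ 1` and `b_i` with `a_i b_j ≠ a_j b_i` (`i ≠ j`),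
`Σ_{1 ≤ n ≤ x} λ(a₁ n + b₁) ⋯ λ(a_k n + b_k) / n = o(log x)` (Tao–Teräväinen, J. Théor. Nombres
Bordeaux 30 (2018), Thm 1.1, PROVE the odd orders `k`; Tao, Forum Math. Pi 4 (2016) the order
`k = 2`, proved in the tree as `Literature.NumberTheory.Sieve.tao_log_chowla_liouville_holds`; the
even orders `k ≥ 4` are OPEN) — implies `LiouvilleCutRank`.  Only the case `k = 4`, `a_i = 4^ℓ`, is used
(`liouvilleCutRank_of_fourPoint_logChowla`). [folklore] -/
theorem liouvilleCutRank_of_logChowla_dilated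
    (h : ∀ (k : ℕ) (a b : Fin k → ℕ), (∀ i, 1 ≤ a i) → (∀ i j, i ≠ j → a i * b j ≠ a j * b i) →
      (fun x : ℕ => ∑ n ∈ Icc 1 x, (∏ i, (liouville (a i * n + b i) : ℝ)) / n) =o[atTop]
        fun x : ℕ => Real.log x) :
    LiouvilleCutRank := by
  apply liouvilleCutRank_of_fourPoint_logChowla
  intro ℓ b₁ b₂ b₃ b₄ h12 h13 h14 h23 h24 h34 _ _ _ _ _ _ _ _
  have ht : 0 < 2 ^ (2 * ℓ) := Nat.two_pow_pos _
  -- the shift vector is injective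
  have hbinj : Function.Injective (![b₁, b₂, b₃, b₄] : Fin 4 → ℕ) := by
    rw [← List.nodup_ofFn]
    simp [List.ofFn_succ, h12, h13, h14, h23, h24, h34]
  have hnd : ∀ i j : Fin 4, i ≠ j →
      (fun _ : Fin 4 => 2 ^ (2 * ℓ)) i * (![b₁, b₂, b₃, b₄] : Fin 4 → ℕ) j ≠
        (fun _ : Fin 4 => 2 ^ (2 * ℓ)) j * (![b₁, b₂, b₃, b₄] : Fin 4 → ℕ) i := by
    intro i j hij heq
    exact hij (hbinj (Nat.eq_of_mul_eq_mul_left ht heq)).symm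
  have hk := h 4 (fun _ => 2 ^ (2 * ℓ)) ![b₁, b₂, b₃, b₄] (fun _ => ht) hnd
  refine hk.congr (fun x => sum_congr rfl fun n _ => ?_) fun _ => rfl
  simp [Fin.prod_univ_four]

/-- ★ **Corollary in the shape of Chowla's conjecture WITH DILATIONS (Tao, Forum Math. Pi 4 (2016)
e8, Conjecture 1.1; un-averaged).**  "Let `k ≥ 1`, let `a₁, …, a_k` be natural numbers and let
`b₁, …, b_k` be distinct nonnegative integers such that `a_i b_j − a_j b_i ≠ 0` for `1 ≤ i < j ≤ k`.
Then `Σ_{n ≤ x} λ(a₁ n + b₁) ⋯ λ(a_k n + b_k) = o(x)`."  This conjecture (OPEN; its case `k = 4`,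
`a_i = 4^ℓ` is all that is used) implies `LiouvilleCutRank`: partial summation (the tree's Cesàro ⇒ logarithmic transfer
`Literature.NumberTheory.Sieve.isLittleO_log_sum_div_of_isLittleO_sum`) reduces it to
`liouvilleCutRank_of_fourPoint_logChowla`.  Appended (same hand).
[cite: TaoFMP2016, Conjecture 1.1] -/
theorem liouvilleCutRank_of_chowla_dilated
    (h : ∀ (k : ℕ) (a b : Fin k → ℕ), (∀ i, 1 ≤ a i) → Function.Injective b →
      (∀ i j, i ≠ j → a i * b j ≠ a j * b i) →
      (fun x : ℕ => ∑ n ∈ Icc 1 x, (∏ i, (liouville (a i * n + b i) : ℝ))) =o[atTop]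
        fun x : ℕ => (x : ℝ)) :
    LiouvilleCutRank := by
  apply liouvilleCutRank_of_fourPoint_logChowla
  intro ℓ b₁ b₂ b₃ b₄ h12 h13 h14 h23 h24 h34 _ _ _ _ _ _ _ _
  have ht : 0 < 2 ^ (2 * ℓ) := Nat.two_pow_pos _
  -- the shift vector is injective
  have hbinj : Function.Injective (![b₁, b₂, b₃, b₄] : Fin 4 → ℕ) := by
    rw [← List.nodup_ofFn]
    simp [List.ofFn_succ, h12, h13, h14, h23, h24, h34]
  have hnd : ∀ i j : Fin 4, i ≠ j →
      (fun _ : Fin 4 => 2 ^ (2 * ℓ)) i * (![b₁, b₂, b₃, b₄] : Fin 4 → ℕ) j ≠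
        (fun _ : Fin 4 => 2 ^ (2 * ℓ)) j * (![b₁, b₂, b₃, b₄] : Fin 4 → ℕ) i := by
    intro i j hij heq
    exact hij (hbinj (Nat.eq_of_mul_eq_mul_left ht heq)).symm
  have hk := Literature.NumberTheory.Sieve.isLittleO_log_sum_div_of_isLittleO_sum
    (h 4 (fun _ => 2 ^ (2 * ℓ)) ![b₁, b₂, b₃, b₄] (fun _ => ht) hbinj hnd)
  refine hk.congr (fun x => sum_congr rfl fun n _ => ?_) fun _ => rfl
  simp [Fin.prod_univ_four]

end Summit.ValiantsHypothesis.ValiantsHypothesis.Theorems.LiouvilleSarnakLiouvilleCutRank.FourPoint
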